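import Mathlib.Analysis.ODE.Gronwall
import Mathlib.Analysis.Calculus.BumpFunction.FiniteDimension
import Literature.Geometry.Lorentzian.CoordEnergyEvolution
import Literature.Geometry.Riemannian.RicciFlowEnergyComparison
import Literature.Geometry.Riemannian.RicciFlowScalarCurvatureEvolution
import Literature.Geometry.Riemannian.RicciDeTurckChartNormSq
import Literature.Geometry.Riemannian.RicciFlowUniqueness
import Literature.Geometry.Riemannian.ChartMeasureComparison
import HarnessLib

/-!
# Uniqueness of the Ricci flow on closed manifolds by the energy method
(discharge of `Literature.Geometry.Riemannian.ricciFlow_uniqueness`)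

We prove the named fact `ricciFlow_uniqueness` (**Hamilton 1982, Thm. 5.1 / Thm. 14.1**;
Topping 2006, Thm. 5.2.2, forward direction): two Ricci flows of Riemannian metrics on `[0, ε]`
on a closed manifold with the same initial metric coincide. The proof formalised here is the
**energy argument of Kotschwar 2014** (Comm. Anal. Geom. 22, Thm. 1 and §2, specialised to the
compact case `α = β = 0`, with `S` the Ricci difference): for `h = g − g̃`, `A = ∇ − ∇̃`,
`P = Ric − Ric̃` the quantity `ℰ(t) = ∫ (|h|² + |A|² + |P|²)` satisfies `ℰ' ≤ C ℰ`, `ℰ(0) = 0`,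
hence `ℰ ≡ 0` — no DeTurck trick and no parabolic existence theory are needed.

The energy is assembled from **chart energies**. Cover `M` by finitely many bi-Lipschitz chart
neighbourhoods `U_m` of the background metric `g₁(0)` (`exists_isOpen_biLipschitz_extChartAt`,
`ChartMeasureComparison.lean`) and smooth bumps `ρ̂_m` on the model space whose unit sets cover
`M`; read both flows in the chart at `z_m` (`chartRep`, a coordinate Ricci flow:
`IsRicciFlow.isMetricFamilyOn_chartRep`, `IsRicciFlow.tDeriv_chartRep_eq`) and put
`E_m(t) = ∫ ρ̂_m² e_m(t) dμ` with `e_m` the energy density of the components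
(`CoordEnergyEstimate.lean`). Then:

* `E_m(t) ≤ C_m ∫₀ᵗ ∫_{supp ρ̂_m} e_m(s) ds` — the localized energy inequality integrated in time
  (`IsMetricFamilyOn.energy_le`, `CoordEnergyEvolution.lean`; `E_m(0) = 0`);
* `∫_{supp ρ̂_m} e_m(s) ≤ C Σ_j E_j(s)` — the energy density read at `z_m` is pointwise bounded by
  the one read at `z_j` (`exists_eDens_chartRep_le`, `RicciFlowEnergyComparison.lean`), the bumps
  cover, and the model-space integrals of the two charts are compared through the Riemannian
  measure of `g₁(0)` (`lintegral_le_and_le_of_biLipschitz` twice — no change of variables);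
* Grönwall: `ℰ = Σ_m E_m` is continuous, `ℰ(t) ≤ C ∫₀ᵗ ℰ`, so `ℰ ≡ 0`
  (`eq_zero_of_le_mul_integral`, from Mathlib's `norm_le_gronwallBound_of_norm_deriv_right_le`);
* `E_m(t) = 0` forces `H = 0` where `ρ̂_m ≠ 0`, i.e. `g₁(t) = g₂(t)` on the unit sets, which
  cover `M`.

Main result: `ricciFlow_uniqueness_holds : ricciFlow_uniqueness`. Everything is proved; no
definition is introduced.

## References

* R. S. Hamilton, *Three-manifolds with positive Ricci curvature*, J. Differential Geom. 17
  (1982) 255–306, Thm. 5.1 (p. 263), Thm. 14.1 (p. 296). [Hamilton1982]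
* B. Kotschwar, *An energy approach to the problem of uniqueness for the Ricci flow*,
  Comm. Anal. Geom. 22 (2014) 149–176 (arXiv:1206.3225), Thm. 1, §1.1, §2.3 Prop. 7. [Kotschwar2014]
* P. Topping, *Lectures on the Ricci flow*, LMS LNS 325, CUP 2006, Thm. 5.2.2. [Topping2006]
* B.-L. Chen, X.-P. Zhu, *Uniqueness of the Ricci flow on complete noncompact manifolds*,
  J. Differential Geom. 74 (2006) 119–154. [ChenZhu2006b]
-/

noncomputable section

set_option maxSynthPendingDepth 3

open Bundle Set Function Filter Module TopologicalSpace MeasureTheory Metric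
open scoped Manifold ContDiff Topology ENNReal NNReal

namespace Literature.Geometry.Riemannian

open Lorentzian Lorentzian.PseudoRiemannianMetric Lorentzian.MetricCoord

/-! ### Generic helpers -/

section Helpers

/-- A function continuous on an open set `V` and vanishing off a closed set `C ⊆ V` is continuous.
[folklore] -/
theorem continuous_of_continuousOn_of_eq_zero' {X : Type*} [TopologicalSpace X] {V C : Set X}
    (hV : IsOpen V) (hC : IsClosed C) (hCV : C ⊆ V) {f : X → ℝ} (hf : ContinuousOn f V)
    (h0 : ∀ x ∉ C, f x = 0) : Continuous f := by
  refine continuous_iff_continuousAt.2 fun x ↦ ?_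
  by_cases hx : x ∈ V
  · exact hf.continuousAt (hV.mem_nhds hx)
  · have hxC : x ∉ C := fun h ↦ hx (hCV h)
    have hev : f =ᶠ[𝓝 x] fun _ ↦ 0 := by
      filter_upwards [hC.isOpen_compl.mem_nhds hxC] with y hy
      exact h0 y hy
    exact (continuousAt_const.congr hev.symm :)

/-- Two continuous bilinear forms agreeing on a basis are equal. [folklore] -/
theorem clm₂_eq_of_basis {E : Type*} [NormedAddCommGroup E] [NormedSpace ℝ E] {ι : Type*}
    (b : Basis ι ℝ E) {B B' : E →L[ℝ] E →L[ℝ] ℝ} (h : ∀ k l, B (b k) (b l) = B' (b k) (b l)) :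
    B = B' := by
  apply ContinuousLinearMap.coe_injective
  refine b.ext fun k ↦ ?_
  change B (b k) = B' (b k)
  apply ContinuousLinearMap.coe_injective
  refine b.ext fun l ↦ ?_
  exact h k l

/-- **Grönwall in integral form for a nonnegative continuous function**: if `0 ≤ f(t) ≤ C ∫₀ᵗ f`
on `[0, T]` then `f ≡ 0` on `[0, T]` (apply Mathlib's
`norm_le_gronwallBound_of_norm_deriv_right_le` to `F(t) = ∫₀ᵗ f`, `F(0) = 0`). [folklore] -/
theorem eq_zero_of_le_mul_integral {f : ℝ → ℝ} {T C : ℝ} (hf : ContinuousOn f (Icc 0 T))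
    (h0 : ∀ t ∈ Icc 0 T, 0 ≤ f t) (hle : ∀ t ∈ Icc 0 T, f t ≤ C * ∫ s in (0 : ℝ)..t, f s) :
    ∀ t ∈ Icc 0 T, f t = 0 := by
  intro t ht
  have hT : 0 ≤ T := ht.1.trans ht.2
  -- continuous extension of `f` to `ℝ`
  set fe : ℝ → ℝ := fun s ↦ f (max 0 (min T s)) with hfe
  have hproj : ∀ s, max 0 (min T s) ∈ Icc 0 T := fun s ↦
    ⟨le_max_left _ _, max_le hT (min_le_left _ _)⟩
  have hfe_eq : ∀ s ∈ Icc 0 T, fe s = f s := fun s hs ↦ by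
    simp only [hfe, min_eq_right hs.2, max_eq_right hs.1]
  have hfec : Continuous fe :=
    hf.comp_continuous (continuous_const.max (continuous_const.min continuous_id)) hproj
  set F : ℝ → ℝ := fun u ↦ ∫ s in (0 : ℝ)..u, fe s with hF
  have hFd : ∀ u, HasDerivAt F (fe u) u := fun u ↦ (hfec.integral_hasStrictDerivAt 0 u).hasDerivAt
  have hFeq : ∀ u ∈ Icc 0 T, F u = ∫ s in (0 : ℝ)..u, f s := fun u hu ↦ by
    refine intervalIntegral.integral_congr fun s hs ↦ hfe_eq s ?_
    rw [uIcc_of_le hu.1] at hs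
    exact ⟨hs.1, hs.2.trans hu.2⟩
  have hF0 : ∀ u ∈ Icc 0 T, 0 ≤ F u := fun u hu ↦ by
    rw [hFeq u hu]
    exact intervalIntegral.integral_nonneg hu.1 fun s hs ↦ h0 s ⟨hs.1, hs.2.trans hu.2⟩
  have hG := norm_le_gronwallBound_of_norm_deriv_right_le (f := F) (f' := fe) (δ := 0) (K := C)
    (ε := 0) (a := 0) (b := T) (fun u _ ↦ (hFd u).continuousAt.continuousWithinAt)
    (fun u _ ↦ (hFd u).hasDerivWithinAt) (by simp [hF]) (fun u hu ↦ ?_)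
  · have h := hG t ht
    rw [gronwallBound_ε0_δ0, norm_le_zero_iff] at h
    have h2 := hle t ht
    rw [← hFeq t ht, h, mul_zero] at h2
    exact le_antisymm h2 (h0 t ht)
  · have hu' : u ∈ Icc 0 T := Ico_subset_Icc_self hu
    rw [hfe_eq u hu', Real.norm_eq_abs, Real.norm_eq_abs, abs_of_nonneg (h0 u hu'),
      abs_of_nonneg (hF0 u hu'), add_zero, hFeq u hu']
    exact hle u hu'

end Helpers

/-! ### Chart energies of two flows: `E(t) = ∫ ρ̂² e(t) dμ` and the energy content `∫_K e(t) dμ` -/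

section ChartEnergy

variable {E : Type*} [NormedAddCommGroup E] [NormedSpace ℝ E] {H : Type*} [TopologicalSpace H]
  {I : ModelWithCorners ℝ E H} [I.Boundaryless] {M : Type*} [TopologicalSpace M]
  [ChartedSpace H M] [IsManifold I ∞ M] [FiniteDimensional ℝ E] [CompleteSpace E]
  [MeasurableSpace E] [BorelSpace E] {ι : Type*} [Fintype ι]

omit [MeasurableSpace E] [BorelSpace E] [CompleteSpace E] [I.Boundaryless] [FiniteDimensional ℝ E] in
/-- The chart representative at time `t` depends only on `g t`. [folklore] -/
theorem chartRep_congr {g₁ g₂ : ℝ → PseudoRiemannianMetric I ∞ E (TangentSpace I : M → Type _)}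
    {t : ℝ} (h : g₁ t = g₂ t) (z : M) : chartRep I g₁ z t = chartRep I g₂ z t := by
  funext y
  simp only [chartRep, gramOpFamily, h]

omit [MeasurableSpace E] [BorelSpace E] [CompleteSpace E] in
/-- The energy density of a pair `(G, G)` vanishes. [folklore] -/
theorem eDens_self (b : Basis ι ℝ E) (G : E → E →L[ℝ] E →L[ℝ] ℝ) (y : E) : eDens b G G y = 0 := by
  simp [eDens, hComp, aComp, pComp, chrDiff, ricDiff]

omit [CompleteSpace E] [BorelSpace E] [I.Boundaryless] in
/-- **The chart energy vanishes when the two metrics agree at that time.** [cite: Kotschwar2014, §2.2] -/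
theorem chartEnergy_eq_zero_of_eq (b : Basis ι ℝ E)
    {g₁ g₂ : ℝ → PseudoRiemannianMetric I ∞ E (TangentSpace I : M → Type _)} {t : ℝ} (h : g₁ t = g₂ t)
    (z : M) (ρ : E → ℝ) (μ : Measure E) : (∫ y, ρ y ^ 2 * eDens b (chartRep I g₁ z t) (chartRep I g₂ z t) y ∂μ) = 0 := by
  simp only [chartRep_congr h z, eDens_self, mul_zero, integral_zero]

omit [BorelSpace E] [CompleteSpace E] [I.Boundaryless] in
/-- The chart energy is nonnegative for `ρ` real. [cite: Kotschwar2014, §2.2] -/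
theorem chartEnergy_nonneg (b : Basis ι ℝ E) (g₁ g₂ : ℝ → PseudoRiemannianMetric I ∞ E (TangentSpace I : M → Type _))
    (z : M) (ρ : E → ℝ) (μ : Measure E) (t : ℝ) : 0 ≤ (∫ y, ρ y ^ 2 * eDens b (chartRep I g₁ z t) (chartRep I g₂ z t) y ∂μ) :=
  integral_nonneg fun _ ↦ mul_nonneg (sq_nonneg _) (eDens_nonneg _)

omit [BorelSpace E] [CompleteSpace E] [I.Boundaryless] in
/-- The energy content is nonnegative. [cite: Kotschwar2014, §2.2] -/
theorem chartEnergyContent_nonneg (b : Basis ι ℝ E) (g₁ g₂ : ℝ → PseudoRiemannianMetric I ∞ E (TangentSpace I : M → Type _))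
    (z : M) (K : Set E) (μ : Measure E) (t : ℝ) : 0 ≤ (∫ y in K, eDens b (chartRep I g₁ z t) (chartRep I g₂ z t) y ∂μ) :=
  integral_nonneg fun _ ↦ eDens_nonneg _

end ChartEnergy

/-! ### One chart: the energy inequality, continuity, and the vanishing of the energy -/

section PerChart

variable {E : Type*} [NormedAddCommGroup E] [NormedSpace ℝ E] {H : Type*} [TopologicalSpace H]
  {I : ModelWithCorners ℝ E H} [I.Boundaryless] {M : Type*} [TopologicalSpace M]
  [ChartedSpace H M] [IsManifold I ∞ M] [FiniteDimensional ℝ E] [CompleteSpace E]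
  [MeasurableSpace E] [BorelSpace E] {μ : Measure E} [μ.IsAddHaarMeasure]
  {ι : Type*} [Fintype ι] (b : Basis ι ℝ E)
  {g₁ g₂ : ℝ → PseudoRiemannianMetric I ∞ E (TangentSpace I : M → Type _)}
  {cov₁ cov₂ : ℝ → CovariantDerivative I E (TangentSpace I : M → Type _)} {ε : ℝ}
  (hε : 0 < ε) (h₁ : IsRicciFlow g₁ cov₁ (Icc 0 ε)) (h₂ : IsRicciFlow g₂ cov₂ (Icc 0 ε))
  (hR₁ : ∀ t ∈ Icc 0 ε, (g₁ t).IsRiemannian) (z : M)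
  {ρ : E → ℝ} (hρ : ContDiff ℝ 1 ρ) (hρc : HasCompactSupport ρ) (hρV : tsupport ρ ⊆ (extChartAt I z).target)

omit [MeasurableSpace E] [BorelSpace E] [Fintype ι] [CompleteSpace E] in
/-- The chart components of a Riemannian metric are positive definite on the chart target.
[folklore] -/
theorem chartRep_pos_of_isRiemannian {t : ℝ} (hR : (g₁ t).IsRiemannian) {y : E}
    (hy : y ∈ (extChartAt I z).target) (v : E) (hv : v ≠ 0) : 0 < chartRep I g₁ z t y v v := by
  have h := chartRep_apply g₁ z t ⟨y, hy⟩ v v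
  rw [h]
  exact chartPullback_pos (g₁ t) z ⟨y, hy⟩ (fun w hw ↦ hR _ w hw) v hv

include hε h₁ h₂ hR₁ hρ hρc hρV in
/-- **The chart energy inequality**: there is `C ≥ 0` with
`E(t) ≤ E(0) + C ∫₀ᵗ ∫_{tsupport ρ̂} e(s) ds` for `t ∈ [0, ε]` (`IsMetricFamilyOn.energy_le` with the
uniform background bound, ellipticity constant and cut-off bounds of the compact set
`tsupport ρ̂ × [0, ε]`). [cite: Kotschwar2014, §2.3, Prop. 7] -/
theorem exists_chartEnergy_le [Nonempty ι] :
    ∃ C : ℝ, 0 ≤ C ∧ ∀ t ∈ Icc 0 ε, (∫ y, ρ y ^ 2 * eDens b (chartRep I g₁ z t) (chartRep I g₂ z t) y ∂μ) ≤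
      (∫ y, ρ y ^ 2 * eDens b (chartRep I g₁ z 0) (chartRep I g₂ z 0) y ∂μ) +
        C * ∫ s in (0 : ℝ)..t, (∫ y in (tsupport ρ), eDens b (chartRep I g₁ z s) (chartRep I g₂ z s) y ∂μ) := by
  have hfam₁ := h₁.isMetricFamilyOn_chartRep hε z
  have hfam₂ := h₂.isMetricFamilyOn_chartRep hε z
  have hfl₁ : ∀ s ∈ Icc 0 ε, ∀ y ∈ (extChartAt I z).target, tDeriv (chartRep I g₁ z) (Icc 0 ε) s y =
      (-2 : ℝ) • ricAt (chartRep I g₁ z s) y := fun s hs y hy ↦ h₁.tDeriv_chartRep_eq hε z hs hy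
  have hfl₂ : ∀ s ∈ Icc 0 ε, ∀ y ∈ (extChartAt I z).target, tDeriv (chartRep I g₂ z) (Icc 0 ε) s y =
      (-2 : ℝ) • ricAt (chartRep I g₂ z s) y := fun s hs y hy ↦ h₂.tDeriv_chartRep_eq hε z hs hy
  have hK : IsCompact (tsupport ρ) := hρc
  have hS : IsCompact (Icc (0 : ℝ) ε) := isCompact_Icc
  -- the uniform background bound
  obtain ⟨N, hN⟩ := hfam₁.exists_pairBound b hfam₂ hK hρV hS
  -- the ellipticity constant
  have hcont : ∀ p q, ContinuousOn (fun x : E × ℝ ↦ ginv (chartRep I g₁ z x.2) b x.1 p q)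
      (tsupport ρ ×ˢ Icc 0 ε) := fun p q ↦
    ((hfam₁.contDiffOn_ginv_family b p q).continuousOn).mono (prod_mono hρV Subset.rfl)
  have hpos : ∀ x ∈ tsupport ρ ×ˢ Icc (0 : ℝ) ε, ∀ ξ : ι → ℝ, ξ ≠ 0 →
      0 < ∑ p, ∑ q, ginv (chartRep I g₁ z x.2) b x.1 p q * ξ p * ξ q := by
    rintro ⟨y, s⟩ ⟨hy, hs⟩ ξ hξ
    exact quadratic_ginv_pos b ((hfam₁.isMetricOn s hs).isInvertible y (hρV hy))
      (fun v hv ↦ chartRep_pos_of_isRiemannian z (hR₁ s hs) (hρV hy) v hv) hξ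
  obtain ⟨lam, hlam, hell⟩ := exists_ellipticity_const (hK.prod hS)
    (Gi := fun (x : E × ℝ) q p ↦ ginv (chartRep I g₁ z x.2) b x.1 p q) (fun p q ↦ hcont p q) hpos
  -- bounds for the cut-off
  obtain ⟨R₀, _, hR₀⟩ := exists_bound_of_hasCompactSupport hρ.continuous hρc
  obtain ⟨R₁, hR₁'⟩ := (hρ.continuous_fderiv one_ne_zero).bounded_above_of_compact_support (hρc.fderiv ℝ)
  refine ⟨energyConst (Fintype.card ι) N lam R₀ (max R₁ 0), energyConst_nonneg _ hlam ?_ (le_max_right _ _),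
    fun t ht ↦ ?_⟩
  · exact (abs_nonneg _).trans (hR₀ 0)
  exact hfam₁.energy_le b hfam₂ hfl₁ hfl₂ hρ hρc hρV hlam (fun s hs y hy ↦ hN (y, s) ⟨hy, hs⟩)
    (fun s hs y hy ξ ↦ hell (y, s) ⟨hy, hs⟩ ξ) hR₀ (fun y ↦ (hR₁' y).trans (le_max_left _ _)) ht

include hε h₁ h₂ hρ hρc hρV in
/-- The chart energy is continuous on `[0, ε]`. [cite: Kotschwar2014, §2.3] -/
theorem continuousOn_chartEnergy :
    ContinuousOn (fun t ↦ (∫ y, ρ y ^ 2 * eDens b (chartRep I g₁ z t) (chartRep I g₂ z t) y ∂μ)) (Icc 0 ε) :=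
  (h₁.isMetricFamilyOn_chartRep hε z).continuousOn_energy b (h₂.isMetricFamilyOn_chartRep hε z) hρ hρc hρV

include hε h₁ h₂ in
/-- The energy content of a compact subset of the chart target is continuous on `[0, ε]`.
[cite: Kotschwar2014, §2.3] -/
theorem continuousOn_chartEnergyContent {K : Set E} (hK : IsCompact K) (hKV : K ⊆ (extChartAt I z).target) :
    ContinuousOn (fun t ↦ (∫ y in K, eDens b (chartRep I g₁ z t) (chartRep I g₂ z t) y ∂μ)) (Icc 0 ε) :=
  (h₁.isMetricFamilyOn_chartRep hε z).continuousOn_setIntegral_eDens b (h₂.isMetricFamilyOn_chartRep hε z) hK hKV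

include hε h₁ h₂ hρ hρc hρV in
/-- **Vanishing chart energy forces equality of the metrics where the cut-off does not vanish**:
if `E(t) = 0`, `t ∈ [0, ε]`, then `g₁(t)_x = g₂(t)_x` at every `x` of the chart domain with
`ρ̂(φ x) ≠ 0` (the integrand is continuous and nonnegative, so `H(t, φ x) = 0`, and the frame of
the trivialization is onto `T_x M`). [cite: Kotschwar2014, §2] -/
theorem val_eq_of_chartEnergy_eq_zero {t : ℝ} (ht : t ∈ Icc 0 ε)
    (h0 : (∫ y, ρ y ^ 2 * eDens b (chartRep I g₁ z t) (chartRep I g₂ z t) y ∂μ) = 0) {x : M} (hx : x ∈ (chartAt H z).source)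
    (hρx : ρ (extChartAt I z x) ≠ 0) : (g₁ t).val x = (g₂ t).val x := by
  have hfam₁ := h₁.isMetricFamilyOn_chartRep hε z
  have hfam₂ := h₂.isMetricFamilyOn_chartRep hε z
  have hV : IsOpen (extChartAt I z).target := isOpen_extChartAt_target z
  set f : E → ℝ := fun y ↦ ρ y ^ 2 * eDens b (chartRep I g₁ z t) (chartRep I g₂ z t) y with hf
  have hcont : ContinuousOn (eDens b (chartRep I g₁ z t) (chartRep I g₂ z t)) (extChartAt I z).target :=
    (hfam₁.isMetricOn t ht).continuousOn_eDens (hfam₂.isMetricOn t ht)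
  have hρ2V : tsupport (fun x ↦ ρ x ^ 2) ⊆ (extChartAt I z).target := by
    rw [show (fun y ↦ ρ y ^ 2) = fun y ↦ ρ y * ρ y from funext fun y ↦ sq (ρ y)]
    exact tsupport_mul_subset_left.trans hρV
  have hfc : Continuous f := continuous_mul_of_tsupport_subset hV (hρ.continuous.pow 2) hρ2V hcont
  have hfi : Integrable f μ := integrable_rhoSq_mul hV hρ hρc hρV hcont
  have hf0 : ∀ y, 0 ≤ f y := fun y ↦ mul_nonneg (sq_nonneg _) (eDens_nonneg _)
  have hae : f =ᵐ[μ] 0 := (integral_eq_zero_iff_of_nonneg (fun y ↦ hf0 y) hfi).1 h0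
  have hfz : f = 0 := (Continuous.ae_eq_iff_eq μ hfc continuous_const).1 hae
  -- at `y = φ x`
  set y := extChartAt I z x with hy
  have hfy : f y = 0 := congrFun hfz y
  have he : eDens b (chartRep I g₁ z t) (chartRep I g₂ z t) y = 0 := by
    rcases mul_eq_zero.1 hfy with h | h
    · exact absurd (pow_eq_zero_iff two_ne_zero |>.1 h) hρx
    · exact h
  -- `Σ H² = 0`
  have hH : ∑ p : ι × ι, hComp b (chartRep I g₁ z t) (chartRep I g₂ z t) y p ^ 2 = 0 := by
    have h1 : 0 ≤ ∑ p : ι × ι, hComp b (chartRep I g₁ z t) (chartRep I g₂ z t) y p ^ 2 :=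
      Finset.sum_nonneg fun p _ ↦ sq_nonneg _
    have h2 : 0 ≤ ∑ τ : ι × ι × ι, aComp b (chartRep I g₁ z t) (chartRep I g₂ z t) y τ ^ 2 :=
      Finset.sum_nonneg fun p _ ↦ sq_nonneg _
    have h3 : 0 ≤ ∑ p : ι × ι, pComp b (chartRep I g₁ z t) (chartRep I g₂ z t) y p ^ 2 :=
      Finset.sum_nonneg fun p _ ↦ sq_nonneg _
    unfold eDens at he
    linarith
  have hHp : ∀ p : ι × ι, hComp b (chartRep I g₁ z t) (chartRep I g₂ z t) y p = 0 := by
    intro p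
    have h := (Finset.sum_eq_zero_iff_of_nonneg (fun p _ ↦ sq_nonneg _)).1 hH p (Finset.mem_univ p)
    exact pow_eq_zero_iff two_ne_zero |>.1 h
  -- the representatives agree at `y`, hence `g₁(t)_x = g₂(t)_x` on the frame
  have hG : chartRep I g₁ z t y = chartRep I g₂ z t y := by
    refine clm₂_eq_of_basis b fun k l ↦ ?_
    have h := hHp (k, l)
    simp only [hComp, _root_.sub_apply] at h
    exact sub_eq_zero.1 h
  have hframe : ∀ v w : E, (g₁ t).val x ((trivializationAt E (TangentSpace I : M → Type _) z).symmL ℝ x v)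
      ((trivializationAt E (TangentSpace I : M → Type _) z).symmL ℝ x w) =
      (g₂ t).val x ((trivializationAt E (TangentSpace I : M → Type _) z).symmL ℝ x v)
      ((trivializationAt E (TangentSpace I : M → Type _) z).symmL ℝ x w) := by
    intro v w
    rw [← chartRep_apply_of_mem g₁ z t hx v w, ← chartRep_apply_of_mem g₂ z t hx v w, ← hy, hG]
  have hb : x ∈ (trivializationAt E (TangentSpace I : M → Type _) z).baseSet := mem_trivializationAt_baseSet_of_mem_chart_source z hx
  ext X Y
  have h := hframe ((trivializationAt E (TangentSpace I : M → Type _) z).continuousLinearMapAt ℝ x X)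
    ((trivializationAt E (TangentSpace I : M → Type _) z).continuousLinearMapAt ℝ x Y)
  rwa [Trivialization.symmL_continuousLinearMapAt _ hb, Trivialization.symmL_continuousLinearMapAt _ hb] at h

end PerChart

/-! ### Across charts: the energy content of one chart is controlled by the sum of the chart energies -/

section Cross

variable {E : Type*} [NormedAddCommGroup E] [NormedSpace ℝ E] {H : Type*} [TopologicalSpace H]
  {I : ModelWithCorners ℝ E H} [I.Boundaryless] {M : Type*} [TopologicalSpace M]
  [ChartedSpace H M] [IsManifold I ∞ M] [FiniteDimensional ℝ E] [CompleteSpace E]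
  [MeasurableSpace E] [BorelSpace E] [T3Space M] [MeasurableSpace M] [BorelSpace M]
  {ι : Type*} [Fintype ι]

omit [FiniteDimensional ℝ E] [CompleteSpace E] [MeasurableSpace E] [BorelSpace E] [T3Space M]
  [MeasurableSpace M] [BorelSpace M] [Fintype ι] [IsManifold I ∞ M] in
/-- The image under the extended chart of an open subset of the chart domain is open. [folklore] -/
theorem isOpen_extChartAt_image (z : M) {U : Set M} (hUo : IsOpen U) (hUs : U ⊆ (chartAt H z).source) :
    IsOpen (extChartAt I z '' U) := by
  have hUs' : U ⊆ (extChartAt I z).source := by rwa [extChartAt_source]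
  rw [(extChartAt I z).image_eq_target_inter_inv_preimage hUs']
  exact (continuousOn_extChartAt_symm z).isOpen_inter_preimage (isOpen_extChartAt_target z) hUo

omit [FiniteDimensional ℝ E] [CompleteSpace E] [MeasurableSpace E] [BorelSpace E] [T3Space M]
  [MeasurableSpace M] [BorelSpace M] [Fintype ι] [IsManifold I ∞ M] [I.Boundaryless] in
/-- A chart cut-off read on the manifold: `x ↦ ρ̂(φ_z x)` on the chart domain, `0` elsewhere, is
continuous and vanishes off the compact set `φ_z⁻¹(tsupport ρ̂) ⊆ U` when `tsupport ρ̂ ⊆ φ_z(U)`,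
`U` inside the chart domain. [folklore] -/
theorem continuous_chartCutoff [T2Space M] (z : M) {U : Set M} (hUs : U ⊆ (chartAt H z).source)
    {ρ : E → ℝ} (hρ : Continuous ρ) (hρK : HasCompactSupport ρ) (hρU : tsupport ρ ⊆ extChartAt I z '' U)
    {u : E → ℝ} (hu : ContinuousOn u (extChartAt I z).target) :
    Continuous (fun x ↦ (chartAt H z).source.indicator (fun x ↦ ρ (extChartAt I z x)) x * u (extChartAt I z x)) ∧
    (∀ x, (chartAt H z).source.indicator (fun x ↦ ρ (extChartAt I z x)) x ≠ 0 →
      x ∈ (extChartAt I z).symm '' tsupport ρ) ∧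
    IsCompact ((extChartAt I z).symm '' tsupport ρ) ∧ (extChartAt I z).symm '' tsupport ρ ⊆ U := by
  set φ := extChartAt I z with hφ
  have hsrc : (chartAt H z).source = φ.source := by rw [hφ, extChartAt_source]
  have hUs' : U ⊆ φ.source := by rwa [← hsrc]
  have hUt : φ '' U ⊆ φ.target := by
    rintro _ ⟨q, hq, rfl⟩; exact φ.map_source (hUs' hq)
  have hKt : tsupport ρ ⊆ φ.target := hρU.trans hUt
  -- the compact set `Φ(tsupport ρ)` and its properties
  have hKc : IsCompact (φ.symm '' tsupport ρ) :=
    hρK.image_of_continuousOn ((continuousOn_extChartAt_symm z).mono hKt)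
  have hKU : φ.symm '' tsupport ρ ⊆ U := by
    rintro _ ⟨y, hy, rfl⟩
    obtain ⟨q, hq, rfl⟩ := hρU hy
    rw [φ.left_inv (hUs' hq)]
    exact hq
  have hsupp : ∀ x, (chartAt H z).source.indicator (fun x ↦ ρ (φ x)) x ≠ 0 → x ∈ φ.symm '' tsupport ρ := by
    intro x hx
    by_cases hxs : x ∈ (chartAt H z).source
    · rw [indicator_of_mem hxs] at hx
      refine ⟨φ x, subset_tsupport _ hx, φ.left_inv (by rwa [← hsrc])⟩
    · exact absurd (indicator_of_notMem hxs _) hx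
  refine ⟨?_, hsupp, hKc, hKU⟩
  refine continuous_of_continuousOn_of_eq_zero' (chartAt H z).open_source hKc.isClosed
    (hKU.trans hUs) ?_ fun x hx ↦ ?_
  · have hφc : ContinuousOn φ (chartAt H z).source := by rw [hsrc]; exact continuousOn_extChartAt z
    have hmaps : MapsTo φ (chartAt H z).source φ.target := fun x hx ↦ φ.map_source (by rwa [← hsrc])
    have h1 : ContinuousOn (fun x ↦ ρ (φ x)) (chartAt H z).source := hρ.comp_continuousOn hφc
    have h2 : ContinuousOn (fun x ↦ u (φ x)) (chartAt H z).source := hu.comp hφc hmaps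
    refine (h1.mul h2).congr fun x hx ↦ ?_
    simp only [indicator_of_mem hx, Pi.mul_apply]
  · have h0 : (chartAt H z).source.indicator (fun x ↦ ρ (φ x)) x = 0 := by
      by_contra h; exact hx (hsupp x h)
    rw [h0, zero_mul]

/-- **The energy content of one chart is controlled by the sum of the chart energies.** Let
`h` be a Riemannian metric, `U_j` bi-Lipschitz chart neighbourhoods (constants `C_j`) for `h`
inside the chart domains of the centres `z_j`, `ρ̂_j, θ̂_j` continuous cut-offs on the model space
compactly supported in `φ_j(U_j)` with `0 ≤ θ̂_j ≤ 1`, `θ̂_j = 1` on `tsupport ρ̂_j`, and suppose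
the squares of the `ρ̂_j ∘ φ_j` sum to at least `1` on `M`. Then there is `D` with, for all
times `s` and every `m`,
`∫_{tsupport ρ̂_m} e_m(s) dμ ≤ D Σ_j ∫ ρ̂_j² e_j(s) dμ`, `μ = μHE[n]` the model Haar measure: the
integrand of chart `m` is pushed to `M` and back to chart `j` through `dVol_h`
(`lintegral_le_and_le_of_biLipschitz`), compared pointwise by `exists_eDens_chartRep_le`.
[cite: Kotschwar2014, §2] -/
theorem exists_chartEnergyContent_le_sum [Nonempty ι] [T2Space M] (b : Basis ι ℝ E)
    (h : PseudoRiemannianMetric I ∞ E (TangentSpace I : M → Type _)) (hh : h.IsRiemannian)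
    (g₁ g₂ : ℝ → PseudoRiemannianMetric I ∞ E (TangentSpace I : M → Type _))
    {κ : Type*} [Fintype κ] (z : κ → M) (U : κ → Set M) (C : κ → ℝ≥0)
    (hUo : ∀ j, IsOpen (U j)) (hUs : ∀ j, U j ⊆ (chartAt H (z j)).source)
    (hup : ∀ j, ∀ q ∈ U j, ∀ q' ∈ U j,
      h.edist hh q q' ≤ C j * edist (extChartAt I (z j) q) (extChartAt I (z j) q'))
    (hlow : ∀ j, ∀ q ∈ U j, ∀ q' ∈ U j,
      edist (extChartAt I (z j) q) (extChartAt I (z j) q') ≤ C j * h.edist hh q q')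
    (ρ θ : κ → E → ℝ) (hρ : ∀ j, Continuous (ρ j)) (hθ : ∀ j, Continuous (θ j))
    (hρK : ∀ j, HasCompactSupport (ρ j)) (hθK : ∀ j, HasCompactSupport (θ j))
    (hρU : ∀ j, tsupport (ρ j) ⊆ extChartAt I (z j) '' U j)
    (hθU : ∀ j, tsupport (θ j) ⊆ extChartAt I (z j) '' U j)
    (hθ0 : ∀ j y, 0 ≤ θ j y) (hθ1 : ∀ j y, θ j y ≤ 1) (hθρ : ∀ j, ∀ y ∈ tsupport (ρ j), θ j y = 1)
    (hcov : ∀ x : M, 1 ≤ ∑ j, ((chartAt H (z j)).source.indicator (fun x ↦ ρ j (extChartAt I (z j) x)) x) ^ 2) :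
    ∃ D : ℝ, 0 ≤ D ∧ ∀ (s : ℝ) (m : κ),
      (∫ y in (tsupport (ρ m)), eDens b (chartRep I g₁ (z m) s) (chartRep I g₂ (z m) s) y ∂(μHE[finrank ℝ E] : Measure E)) ≤
        D * ∑ j, (∫ y, (ρ j) y ^ 2 * eDens b (chartRep I g₁ (z j) s) (chartRep I g₂ (z j) s) y ∂(μHE[finrank ℝ E] : Measure E)) := by
  set n := finrank ℝ E with hn
  set μE : Measure E := μHE[n] with hμE
  set φ : κ → PartialEquiv M E := fun j ↦ extChartAt I (z j) with hφ
  -- the chart cut-offs read on `M`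
  set ρM : κ → M → ℝ := fun j x ↦ (chartAt H (z j)).source.indicator (fun x ↦ ρ j (φ j x)) x with hρM
  set θM : κ → M → ℝ := fun j x ↦ (chartAt H (z j)).source.indicator (fun x ↦ θ j (φ j x)) x with hθM
  -- compact sets
  set Kρ : κ → Set M := fun j ↦ (φ j).symm '' tsupport (ρ j) with hKρ
  set Kθ : κ → Set M := fun j ↦ (φ j).symm '' tsupport (θ j) with hKθ
  have hρdata := fun j ↦ continuous_chartCutoff (I := I) (z j) (hUs j) (hρ j) (hρK j) (hρU j)
    (u := fun _ ↦ (1 : ℝ)) continuousOn_const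
  have hθdata := fun j ↦ continuous_chartCutoff (I := I) (z j) (hUs j) (hθ j) (hθK j) (hθU j)
    (u := fun _ ↦ (1 : ℝ)) continuousOn_const
  have hKρc : ∀ j, IsCompact (Kρ j) := fun j ↦ (hρdata j).2.2.1
  have hKθc : ∀ j, IsCompact (Kθ j) := fun j ↦ (hθdata j).2.2.1
  have hKρU : ∀ j, Kρ j ⊆ U j := fun j ↦ (hρdata j).2.2.2
  have hKθU : ∀ j, Kθ j ⊆ U j := fun j ↦ (hθdata j).2.2.2
  have hρMs : ∀ j x, ρM j x ≠ 0 → x ∈ Kρ j := fun j ↦ (hρdata j).2.1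
  have hθMs : ∀ j x, θM j x ≠ 0 → x ∈ Kθ j := fun j ↦ (hθdata j).2.1
  -- comparison constants on `Kθ m ∩ Kρ j`
  have hcmp : ∀ m j, ∃ Cc : ℝ, 0 ≤ Cc ∧ ∀ (s : ℝ), ∀ x ∈ Kθ m ∩ Kρ j,
      eDens b (chartRep I g₁ (z m) s) (chartRep I g₂ (z m) s) (extChartAt I (z m) x) ≤
        Cc * eDens b (chartRep I g₁ (z j) s) (chartRep I g₂ (z j) s) (extChartAt I (z j) x) := fun m j ↦
    exists_eDens_chartRep_le b g₁ g₂ (z m) (z j) ((hKθc m).inter_right (hKρc j).isClosed)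
      (fun x hx ↦ hUs m (hKθU m hx.1)) (fun x hx ↦ hUs j (hKρU j hx.2))
  choose Cc hCc0 hCc using hcmp
  -- the constant
  set D : ℝ := ∑ m, ∑ j, (C m : ℝ) ^ n * Cc m j * (C j : ℝ) ^ n with hD
  have hcoef0 : ∀ m j, 0 ≤ (C m : ℝ) ^ n * Cc m j * (C j : ℝ) ^ n := fun m j ↦ by
    have := hCc0 m j; positivity
  have hcoefD : ∀ m j, (C m : ℝ) ^ n * Cc m j * (C j : ℝ) ^ n ≤ D := fun m j ↦ by
    rw [hD]
    calc (C m : ℝ) ^ n * Cc m j * (C j : ℝ) ^ n ≤ ∑ j', (C m : ℝ) ^ n * Cc m j' * (C j' : ℝ) ^ n :=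
          Finset.single_le_sum (f := fun j' ↦ (C m : ℝ) ^ n * Cc m j' * (C j' : ℝ) ^ n)
            (fun j' _ ↦ hcoef0 m j') (Finset.mem_univ j)
      _ ≤ ∑ m', ∑ j', (C m' : ℝ) ^ n * Cc m' j' * (C j' : ℝ) ^ n :=
          Finset.single_le_sum (f := fun m' ↦ ∑ j', (C m' : ℝ) ^ n * Cc m' j' * (C j' : ℝ) ^ n)
            (fun m' _ ↦ Finset.sum_nonneg fun j' _ ↦ hcoef0 m' j') (Finset.mem_univ m)
  have hD0 : 0 ≤ D := Finset.sum_nonneg fun m _ ↦ Finset.sum_nonneg fun j _ ↦ hcoef0 m j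
  refine ⟨D, hD0, fun s m ↦ ?_⟩
  -- the densities at time `s`
  set e : κ → E → ℝ := fun j y ↦ eDens b (chartRep I g₁ (z j) s) (chartRep I g₂ (z j) s) y with he
  have hG : ∀ j, IsMetricOn (chartRep I g₁ (z j) s) (φ j).target := fun j ↦
    Lorentzian.OpensChart.isMetricOn_repr (val_chartPullback_eq_chartRep g₁ (z j) s)
  have hG' : ∀ j, IsMetricOn (chartRep I g₂ (z j) s) (φ j).target := fun j ↦
    Lorentzian.OpensChart.isMetricOn_repr (val_chartPullback_eq_chartRep g₂ (z j) s)
  have hec : ∀ j, ContinuousOn (e j) (φ j).target := fun j ↦ (hG j).continuousOn_eDens (hG' j)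
  have he0 : ∀ j y, 0 ≤ e j y := fun j y ↦ eDens_nonneg _
  -- the two functions on `M`
  set Fm : M → ℝ≥0∞ := fun x ↦ ENNReal.ofReal (θM m x * e m (φ m x)) with hFm
  set Fj : κ → M → ℝ≥0∞ := fun j x ↦ ENNReal.ofReal (ρM j x ^ 2 * e j (φ j x)) with hFj
  have hFmc : Continuous fun x ↦ θM m x * e m (φ m x) :=
    (continuous_chartCutoff (I := I) (z m) (hUs m) (hθ m) (hθK m) (hθU m) (hec m)).1
  have hFjc : ∀ j, Continuous fun x ↦ ρM j x ^ 2 * e j (φ j x) := by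
    intro j
    have h1 := (continuous_chartCutoff (I := I) (z j) (hUs j) (hρ j) (hρK j) (hρU j) (hec j)).1
    have h2 := (hρdata j).1
    simp only [mul_one] at h2
    have : (fun x ↦ ρM j x ^ 2 * e j (φ j x)) = fun x ↦ ρM j x * (ρM j x * e j (φ j x)) := by
      funext x; ring
    rw [this]
    exact h2.mul h1
  have hFm_meas : Measurable Fm := hFmc.measurable.ennreal_ofReal
  have hFj_meas : ∀ j, Measurable (Fj j) := fun j ↦ (hFjc j).measurable.ennreal_ofReal
  -- the pointwise comparison on `M`
  have hpt : ∀ x, Fm x ≤ ∑ j, ENNReal.ofReal (Cc m j) * Fj j x := by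
    intro x
    by_cases hθx : θM m x = 0
    · simp only [hFm, hθx, zero_mul, ENNReal.ofReal_zero, zero_le]
    have hxm : x ∈ Kθ m := hθMs m x hθx
    have hxs : x ∈ (chartAt H (z m)).source := hUs m (hKθU m hxm)
    have hθle : θM m x ≤ 1 := by
      simp only [hθM, indicator_of_mem hxs]; exact hθ1 m _
    have hθge : 0 ≤ θM m x := by
      simp only [hθM, indicator_of_mem hxs]; exact hθ0 m _
    have hem0 : 0 ≤ e m (φ m x) := he0 m _
    -- real inequality
    have hreal : θM m x * e m (φ m x) ≤ ∑ j, Cc m j * (ρM j x ^ 2 * e j (φ j x)) := by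
      have h1 : θM m x * e m (φ m x) ≤ e m (φ m x) := by
        calc θM m x * e m (φ m x) ≤ 1 * e m (φ m x) := mul_le_mul_of_nonneg_right hθle hem0
          _ = e m (φ m x) := one_mul _
      have h2 : e m (φ m x) ≤ ∑ j, ρM j x ^ 2 * e m (φ m x) := by
        rw [← Finset.sum_mul]
        calc e m (φ m x) = 1 * e m (φ m x) := (one_mul _).symm
          _ ≤ (∑ j, ρM j x ^ 2) * e m (φ m x) := mul_le_mul_of_nonneg_right (hcov x) hem0
      have h3 : ∀ j, ρM j x ^ 2 * e m (φ m x) ≤ Cc m j * (ρM j x ^ 2 * e j (φ j x)) := by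
        intro j
        by_cases hρx : ρM j x = 0
        · rw [hρx]; simp
        have hxj : x ∈ Kρ j := hρMs j x hρx
        have hcomp := hCc m j s x ⟨hxm, hxj⟩
        calc ρM j x ^ 2 * e m (φ m x) ≤ ρM j x ^ 2 * (Cc m j * e j (φ j x)) :=
              mul_le_mul_of_nonneg_left hcomp (sq_nonneg _)
          _ = Cc m j * (ρM j x ^ 2 * e j (φ j x)) := by ring
      exact h1.trans (h2.trans (Finset.sum_le_sum fun j _ ↦ h3 j))
    calc Fm x = ENNReal.ofReal (θM m x * e m (φ m x)) := rfl
      _ ≤ ENNReal.ofReal (∑ j, Cc m j * (ρM j x ^ 2 * e j (φ j x))) := ENNReal.ofReal_le_ofReal hreal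
      _ = ∑ j, ENNReal.ofReal (Cc m j * (ρM j x ^ 2 * e j (φ j x))) :=
          ENNReal.ofReal_sum_of_nonneg fun j _ ↦ mul_nonneg (hCc0 m j) (mul_nonneg (sq_nonneg _) (he0 j _))
      _ = ∑ j, ENNReal.ofReal (Cc m j) * Fj j x := by
          refine Finset.sum_congr rfl fun j _ ↦ ?_
          rw [hFj, ENNReal.ofReal_mul (hCc0 m j)]
  -- (1) the energy content as a lintegral over `φ_m(U_m)`
  have hKm : tsupport (ρ m) ⊆ φ m '' U m := hρU m
  have hUmo : IsOpen (φ m '' U m) := isOpen_extChartAt_image (z m) (hUo m) (hUs m)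
  have hUmt : φ m '' U m ⊆ (φ m).target := by
    rintro _ ⟨q, hq, rfl⟩; exact (φ m).map_source (by rw [extChartAt_source]; exact hUs m hq)
  have hKmeas : MeasurableSet (tsupport (ρ m)) := (isClosed_tsupport _).measurableSet
  have hcontent : ENNReal.ofReal ((∫ y in (tsupport (ρ m)), eDens b (chartRep I g₁ (z m) s) (chartRep I g₂ (z m) s) y ∂μE)) =
      ∫⁻ y in tsupport (ρ m), ENNReal.ofReal (e m y) ∂μE := by
    refine ofReal_integral_eq_lintegral_ofReal ?_ (Eventually.of_forall fun y ↦ he0 m y)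
    exact ((hec m).mono (hKm.trans hUmt)).integrableOn_compact (hρK m)
  have hstep1 : ∫⁻ y in tsupport (ρ m), ENNReal.ofReal (e m y) ∂μE ≤
      ∫⁻ y in φ m '' U m, Fm ((φ m).symm y) ∂μE := by
    calc ∫⁻ y in tsupport (ρ m), ENNReal.ofReal (e m y) ∂μE
        = ∫⁻ y in tsupport (ρ m), Fm ((φ m).symm y) ∂μE := by
          refine setLIntegral_congr_fun hKmeas fun y hy ↦ ?_
          have hyt : y ∈ (φ m).target := hUmt (hKm hy)
          have hys : (φ m).symm y ∈ (chartAt H (z m)).source := by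
            rw [← extChartAt_source I]; exact (φ m).map_target hyt
          simp only [hFm, hθM, indicator_of_mem hys, (φ m).right_inv hyt, hθρ m y hy, one_mul]
      _ ≤ ∫⁻ y in φ m '' U m, Fm ((φ m).symm y) ∂μE := lintegral_mono_set hKm
  -- (2) to the manifold
  have hstep2 : ∫⁻ y in φ m '' U m, Fm ((φ m).symm y) ∂μE ≤ (C m : ℝ≥0∞) ^ n * ∫⁻ x in U m, Fm x ∂h.riemVolume :=
    (lintegral_le_and_le_of_biLipschitz h hh (z m) (hUo m) (hUs m) (hup m) (hlow m) hFm_meas).2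
  -- (3) the pointwise comparison, integrated
  have hstep3 : ∫⁻ x in U m, Fm x ∂h.riemVolume ≤ ∑ j, ENNReal.ofReal (Cc m j) * ∫⁻ x, Fj j x ∂h.riemVolume := by
    calc ∫⁻ x in U m, Fm x ∂h.riemVolume ≤ ∫⁻ x in U m, ∑ j, ENNReal.ofReal (Cc m j) * Fj j x ∂h.riemVolume :=
          lintegral_mono fun x ↦ hpt x
      _ ≤ ∫⁻ x, ∑ j, ENNReal.ofReal (Cc m j) * Fj j x ∂h.riemVolume := setLIntegral_le_lintegral _ _
      _ = ∑ j, ∫⁻ x, ENNReal.ofReal (Cc m j) * Fj j x ∂h.riemVolume :=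
          lintegral_finsetSum _ fun j _ ↦ (hFj_meas j).const_mul _
      _ = ∑ j, ENNReal.ofReal (Cc m j) * ∫⁻ x, Fj j x ∂h.riemVolume := by
          refine Finset.sum_congr rfl fun j _ ↦ ?_
          rw [lintegral_const_mul _ (hFj_meas j)]
  -- (4) back to the chart `j`
  have hstep4 : ∀ j, ∫⁻ x, Fj j x ∂h.riemVolume ≤
      (C j : ℝ≥0∞) ^ n * ENNReal.ofReal ((∫ y, (ρ j) y ^ 2 * eDens b (chartRep I g₁ (z j) s) (chartRep I g₂ (z j) s) y ∂μE)) := by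
    intro j
    have hUjt : φ j '' U j ⊆ (φ j).target := by
      rintro _ ⟨q, hq, rfl⟩; exact (φ j).map_source (by rw [extChartAt_source]; exact hUs j hq)
    have hsuppj : support (Fj j) ⊆ U j := by
      intro x hx
      rw [mem_support] at hx
      have hρx : ρM j x ≠ 0 := by
        intro h0
        apply hx
        simp only [hFj, h0]; simp
      exact hKρU j (hρMs j x hρx)
    have h1 : ∫⁻ x, Fj j x ∂h.riemVolume = ∫⁻ x in U j, Fj j x ∂h.riemVolume :=
      (setLIntegral_eq_of_support_subset hsuppj).symm
    have h2 := (lintegral_le_and_le_of_biLipschitz h hh (z j) (hUo j) (hUs j) (hup j) (hlow j) (hFj_meas j)).1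
    have hUjo : IsOpen (φ j '' U j) := isOpen_extChartAt_image (z j) (hUo j) (hUs j)
    have h3 : ∫⁻ y in φ j '' U j, Fj j ((φ j).symm y) ∂μE =
        ∫⁻ y in φ j '' U j, ENNReal.ofReal (ρ j y ^ 2 * e j y) ∂μE := by
      refine setLIntegral_congr_fun hUjo.measurableSet fun y hy ↦ ?_
      have hyt : y ∈ (φ j).target := hUjt hy
      have hys : (φ j).symm y ∈ (chartAt H (z j)).source := by
        rw [← extChartAt_source I]; exact (φ j).map_target hyt
      simp only [hFj, hρM, indicator_of_mem hys, (φ j).right_inv hyt]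
    -- integrability of the chart energy integrand
    have hint : Integrable (fun y ↦ ρ j y ^ 2 * e j y) μE := by
      have hρ2V : tsupport (fun y ↦ ρ j y ^ 2) ⊆ (φ j).target := by
        rw [show (fun y ↦ ρ j y ^ 2) = fun y ↦ ρ j y * ρ j y from funext fun y ↦ sq (ρ j y)]
        exact tsupport_mul_subset_left.trans ((hρU j).trans hUjt)
      have hc : Continuous fun y ↦ ρ j y ^ 2 * e j y :=
        continuous_mul_of_tsupport_subset (isOpen_extChartAt_target (z j)) ((hρ j).pow 2) hρ2V (hec j)
      have heq : (fun y ↦ ρ j y ^ 2 * e j y) = fun y ↦ ρ j y * (ρ j y * e j y) := by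
        funext y; ring
      have hcs : HasCompactSupport fun y ↦ ρ j y ^ 2 * e j y := by
        rw [heq]; exact (hρK j).mul_right
      exact hc.integrable_of_hasCompactSupport hcs
    have h4 : ∫⁻ y in φ j '' U j, ENNReal.ofReal (ρ j y ^ 2 * e j y) ∂μE ≤
        ENNReal.ofReal ((∫ y, (ρ j) y ^ 2 * eDens b (chartRep I g₁ (z j) s) (chartRep I g₂ (z j) s) y ∂μE)) := by
      rw [ofReal_integral_eq_lintegral_ofReal hint
        (Eventually.of_forall fun y ↦ mul_nonneg (sq_nonneg _) (he0 j y))]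
      exact setLIntegral_le_lintegral _ _
    calc ∫⁻ x, Fj j x ∂h.riemVolume = ∫⁻ x in U j, Fj j x ∂h.riemVolume := h1
      _ ≤ (C j : ℝ≥0∞) ^ n * ∫⁻ y in φ j '' U j, Fj j ((φ j).symm y) ∂μE := h2
      _ = (C j : ℝ≥0∞) ^ n * ∫⁻ y in φ j '' U j, ENNReal.ofReal (ρ j y ^ 2 * e j y) ∂μE := by rw [h3]
      _ ≤ (C j : ℝ≥0∞) ^ n * ENNReal.ofReal ((∫ y, (ρ j) y ^ 2 * eDens b (chartRep I g₁ (z j) s) (chartRep I g₂ (z j) s) y ∂μE)) := mul_le_mul_right h4 _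
  -- (5) assemble in `ℝ≥0∞`, then return to `ℝ`
  have hE0 : ∀ j, 0 ≤ (∫ y, (ρ j) y ^ 2 * eDens b (chartRep I g₁ (z j) s) (chartRep I g₂ (z j) s) y ∂μE) := fun j ↦ chartEnergy_nonneg b g₁ g₂ (z j) (ρ j) μE s
  have hcoe : ∀ j, (C j : ℝ≥0∞) ^ n = ENNReal.ofReal ((C j : ℝ) ^ n) := fun j ↦ by
    rw [ENNReal.ofReal_pow (NNReal.coe_nonneg _), ENNReal.ofReal_coe_nnreal]
  have hreal : ∑ j, (C m : ℝ) ^ n * (Cc m j * ((C j : ℝ) ^ n * (∫ y, (ρ j) y ^ 2 * eDens b (chartRep I g₁ (z j) s) (chartRep I g₂ (z j) s) y ∂μE))) ≤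
      D * ∑ j, (∫ y, (ρ j) y ^ 2 * eDens b (chartRep I g₁ (z j) s) (chartRep I g₂ (z j) s) y ∂μE) := by
    rw [Finset.mul_sum]
    refine Finset.sum_le_sum fun j _ ↦ ?_
    calc (C m : ℝ) ^ n * (Cc m j * ((C j : ℝ) ^ n * (∫ y, (ρ j) y ^ 2 * eDens b (chartRep I g₁ (z j) s) (chartRep I g₂ (z j) s) y ∂μE)))
        = ((C m : ℝ) ^ n * Cc m j * (C j : ℝ) ^ n) * (∫ y, (ρ j) y ^ 2 * eDens b (chartRep I g₁ (z j) s) (chartRep I g₂ (z j) s) y ∂μE) := by ring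
      _ ≤ D * (∫ y, (ρ j) y ^ 2 * eDens b (chartRep I g₁ (z j) s) (chartRep I g₂ (z j) s) y ∂μE) := mul_le_mul_of_nonneg_right (hcoefD m j) (hE0 j)
  have hfin : ENNReal.ofReal ((∫ y in (tsupport (ρ m)), eDens b (chartRep I g₁ (z m) s) (chartRep I g₂ (z m) s) y ∂μE)) ≤
      ENNReal.ofReal (D * ∑ j, (∫ y, (ρ j) y ^ 2 * eDens b (chartRep I g₁ (z j) s) (chartRep I g₂ (z j) s) y ∂μE)) := by
    calc ENNReal.ofReal ((∫ y in (tsupport (ρ m)), eDens b (chartRep I g₁ (z m) s) (chartRep I g₂ (z m) s) y ∂μE))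
        = ∫⁻ y in tsupport (ρ m), ENNReal.ofReal (e m y) ∂μE := hcontent
      _ ≤ ∫⁻ y in φ m '' U m, Fm ((φ m).symm y) ∂μE := hstep1
      _ ≤ (C m : ℝ≥0∞) ^ n * ∫⁻ x in U m, Fm x ∂h.riemVolume := hstep2
      _ ≤ (C m : ℝ≥0∞) ^ n * ∑ j, ENNReal.ofReal (Cc m j) * ∫⁻ x, Fj j x ∂h.riemVolume :=
          mul_le_mul_right hstep3 _
      _ ≤ (C m : ℝ≥0∞) ^ n * ∑ j, ENNReal.ofReal (Cc m j) *
            ((C j : ℝ≥0∞) ^ n * ENNReal.ofReal ((∫ y, (ρ j) y ^ 2 * eDens b (chartRep I g₁ (z j) s) (chartRep I g₂ (z j) s) y ∂μE))) := by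
          gcongr with j
          exact hstep4 j
      _ = ENNReal.ofReal (∑ j, (C m : ℝ) ^ n *
            (Cc m j * ((C j : ℝ) ^ n * (∫ y, (ρ j) y ^ 2 * eDens b (chartRep I g₁ (z j) s) (chartRep I g₂ (z j) s) y ∂μE)))) := by
          rw [ENNReal.ofReal_sum_of_nonneg fun j _ ↦ ?_, Finset.mul_sum]
          · refine Finset.sum_congr rfl fun j _ ↦ ?_
            rw [hcoe m, hcoe j, ENNReal.ofReal_mul (pow_nonneg (NNReal.coe_nonneg _) n),
              ENNReal.ofReal_mul (hCc0 m j), ENNReal.ofReal_mul (pow_nonneg (NNReal.coe_nonneg _) n)]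
          · exact mul_nonneg (pow_nonneg (NNReal.coe_nonneg _) _) (mul_nonneg (hCc0 m j)
              (mul_nonneg (pow_nonneg (NNReal.coe_nonneg _) _) (hE0 j)))
      _ ≤ ENNReal.ofReal (D * ∑ j, (∫ y, (ρ j) y ^ 2 * eDens b (chartRep I g₁ (z j) s) (chartRep I g₂ (z j) s) y ∂μE)) := ENNReal.ofReal_le_ofReal hreal
  have hRHS0 : 0 ≤ D * ∑ j, (∫ y, (ρ j) y ^ 2 * eDens b (chartRep I g₁ (z j) s) (chartRep I g₂ (z j) s) y ∂μE) :=
    mul_nonneg hD0 (Finset.sum_nonneg fun j _ ↦ hE0 j)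
  exact (ENNReal.ofReal_le_ofReal_iff hRHS0).1 hfin

end Cross

/-! ### The discharge -/

section Main

open Lorentzian.PseudoRiemannianMetric

universe u v w

/-- Any two pseudo-Riemannian metrics on a manifold modelled on a zero-dimensional space agree
(the tangent spaces are trivial). [folklore] -/
theorem pseudoRiemannianMetric_eq_of_finrank_eq_zero {E : Type u} [NormedAddCommGroup E]
    [NormedSpace ℝ E] [FiniteDimensional ℝ E] {H : Type v} [TopologicalSpace H]
    {I : ModelWithCorners ℝ E H} {M : Type w} [TopologicalSpace M] [ChartedSpace H M]
    [IsManifold I ∞ M] (hn : finrank ℝ E = 0)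
    (g g' : PseudoRiemannianMetric I ∞ E (TangentSpace I : M → Type _)) :
    g = g' := by
  haveI hE : Subsingleton E := Module.finrank_zero_iff.1 hn
  refine pseudoRiemannianMetric_eq_of_val_apply_eq fun x X Y ↦ ?_
  have hX : X = 0 := @Subsingleton.elim E hE X 0
  simp only [hX, map_zero, _root_.zero_apply]

set_option maxHeartbeats 400000 in
/-- **DISCHARGE of the named fact `ricciFlow_uniqueness`** (Hamilton 1982, Thm. 5.1 / Thm. 14.1;
Topping 2006, Thm. 5.2.2, forward direction): two Ricci flows of Riemannian metrics on `[0, ε]`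
on a closed manifold with the same initial metric coincide on `[0, ε]`. The proof is the energy
argument of Kotschwar 2014 (Thm. 1, compact case), assembled from the chart energies as described
in the module docstring. [cite: Hamilton1982, §5, Thm. 5.1 (p. 263) and §14, Thm. 14.1 (p. 296)]
[cite: Kotschwar2014, Thm. 1, §2.3 Prop. 7] [cite: Topping2006, Thm. 5.2.2] -/
theorem ricciFlow_uniqueness_holds : ricciFlow_uniqueness.{u, v, w} := by
  intro E _ _ _ _ H _ I _ M _ _ _ _ _ _ ε hε g₁ g₂ cov₁ cov₂ h₁ h₂ hR₁ hR₂ h0 t ht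
  -- dimension zero is trivial
  rcases Nat.eq_zero_or_pos (finrank ℝ E) with hn | hn
  · exact pseudoRiemannianMetric_eq_of_finrank_eq_zero hn _ _
  -- measurable structures, the model measure, a basis
  letI : MeasurableSpace E := borel E
  haveI : BorelSpace E := ⟨rfl⟩
  letI : MeasurableSpace M := borel M
  haveI : BorelSpace M := ⟨rfl⟩
  set n := finrank ℝ E with hndef
  set μE : Measure E := μHE[n] with hμE
  set b := Module.finBasis ℝ E with hb
  haveI : Nonempty (Fin (finrank ℝ E)) := ⟨⟨0, hn⟩⟩
  have hbg : (g₁ 0).IsRiemannian := hR₁ 0 ⟨le_rfl, hε.le⟩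
  -- (1) bi-Lipschitz chart neighbourhoods and balls in the charts
  have key : ∀ x₀ : M, ∃ (U : Set M) (C : ℝ≥0) (R : ℝ), IsOpen U ∧ x₀ ∈ U ∧ U ⊆ (chartAt H x₀).source ∧
      (∀ q ∈ U, ∀ q' ∈ U, (g₁ 0).edist hbg q q' ≤ C * edist (extChartAt I x₀ q) (extChartAt I x₀ q')) ∧
      (∀ q ∈ U, ∀ q' ∈ U, edist (extChartAt I x₀ q) (extChartAt I x₀ q') ≤ C * (g₁ 0).edist hbg q q') ∧
      0 < R ∧ closedBall (extChartAt I x₀ x₀) R ⊆ extChartAt I x₀ '' U := by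
    intro x₀
    obtain ⟨U, hUo, hx₀, hUs, C, -, hup, hlow, -⟩ := exists_isOpen_biLipschitz_extChartAt (g₁ 0) hbg x₀
    have hVo : IsOpen (extChartAt I x₀ '' U) := isOpen_extChartAt_image x₀ hUo hUs
    have hmem : extChartAt I x₀ x₀ ∈ extChartAt I x₀ '' U := mem_image_of_mem _ hx₀
    obtain ⟨R₀, hR₀, hballU⟩ := Metric.isOpen_iff.1 hVo _ hmem
    refine ⟨U, C, R₀ / 2, hUo, hx₀, hUs, hup, hlow, by positivity, ?_⟩
    exact (closedBall_subset_ball (by linarith)).trans hballU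
  choose U C R hUo hxU hUs hup hlow hR hball using key
  -- the bumps: `ρ̂` (unit on the ball of radius `R/4`, supported in `R/2`) and `θ̂` (unit on `R/2`,
  -- supported in `R`)
  set ρB : ∀ x₀ : M, ContDiffBump (extChartAt I x₀ x₀) := fun x₀ ↦
    ⟨R x₀ / 4, R x₀ / 2, by have := hR x₀; positivity, by have := hR x₀; linarith⟩ with hρB
  set θB : ∀ x₀ : M, ContDiffBump (extChartAt I x₀ x₀) := fun x₀ ↦
    ⟨R x₀ / 2, R x₀, by have := hR x₀; positivity, by have := hR x₀; linarith⟩ with hθB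
  have hρsupp : ∀ x₀, tsupport (ρB x₀ : E → ℝ) = closedBall (extChartAt I x₀ x₀) (R x₀ / 2) := fun x₀ ↦
    (ρB x₀).tsupport_eq
  have hθsupp : ∀ x₀, tsupport (θB x₀ : E → ℝ) = closedBall (extChartAt I x₀ x₀) (R x₀) := fun x₀ ↦
    (θB x₀).tsupport_eq
  have hρU : ∀ x₀, tsupport (ρB x₀ : E → ℝ) ⊆ extChartAt I x₀ '' U x₀ := fun x₀ ↦ by
    rw [hρsupp]
    exact (closedBall_subset_closedBall (by have := hR x₀; linarith)).trans (hball x₀)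
  have hθU : ∀ x₀, tsupport (θB x₀ : E → ℝ) ⊆ extChartAt I x₀ '' U x₀ := fun x₀ ↦ by
    rw [hθsupp]; exact hball x₀
  have hUt : ∀ x₀, extChartAt I x₀ '' U x₀ ⊆ (extChartAt I x₀).target := fun x₀ ↦ by
    rintro _ ⟨q, hq, rfl⟩
    exact (extChartAt I x₀).map_source (by rw [extChartAt_source]; exact hUs x₀ hq)
  -- (2) the finite cover by the unit sets of the `ρ̂`
  set W : M → Set M := fun x₀ ↦ U x₀ ∩ extChartAt I x₀ ⁻¹' ball (extChartAt I x₀ x₀) (R x₀ / 4) with hW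
  have hWo : ∀ x₀, IsOpen (W x₀) := fun x₀ ↦ by
    have hc : ContinuousOn (extChartAt I x₀) (U x₀) :=
      (continuousOn_extChartAt x₀).mono (by rw [extChartAt_source]; exact hUs x₀)
    exact hc.isOpen_inter_preimage (hUo x₀) isOpen_ball
  have hxW : ∀ x₀, x₀ ∈ W x₀ := fun x₀ ↦ ⟨hxU x₀, by
    simp only [mem_preimage, Metric.mem_ball, dist_self]
    have := hR x₀; positivity⟩
  obtain ⟨tF, htF⟩ := isCompact_univ.elim_finite_subcover W hWo (fun x _ ↦ mem_iUnion.2 ⟨x, hxW x⟩)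
  have hcover : ∀ x : M, ∃ j ∈ tF, x ∈ W j := fun x ↦ by
    have hx := htF (mem_univ x)
    simp only [mem_iUnion] at hx
    obtain ⟨j, hj, hxj⟩ := hx
    exact ⟨j, hj, hxj⟩
  -- where `x ∈ W j`, the cut-off `ρ̂_j` equals `1` at `φ_j x`
  have hone : ∀ (j x : M), x ∈ W j → (ρB j : E → ℝ) (extChartAt I j x) = 1 := fun j x hx ↦
    (ρB j).one_of_mem_closedBall (ball_subset_closedBall hx.2)
  -- (3) the cross-chart constant
  obtain ⟨D, hD0, hD⟩ := exists_chartEnergyContent_le_sum (I := I) b (g₁ 0) hbg g₁ g₂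
    (κ := ↥tF) (fun j ↦ (j : M)) (fun j ↦ U j) (fun j ↦ C j) (fun j ↦ hUo j) (fun j ↦ hUs j)
    (fun j ↦ hup j) (fun j ↦ hlow j) (fun j ↦ (ρB j : E → ℝ)) (fun j ↦ (θB j : E → ℝ))
    (fun j ↦ (ρB (j : M)).continuous) (fun j ↦ (θB (j : M)).continuous)
    (fun j ↦ (ρB (j : M)).hasCompactSupport) (fun j ↦ (θB (j : M)).hasCompactSupport)
    (fun j ↦ hρU j) (fun j ↦ hθU j) (fun j y ↦ (θB (j : M)).nonneg) (fun j y ↦ (θB (j : M)).le_one)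
    (fun j y hy ↦ (θB (j : M)).one_of_mem_closedBall (by rw [hρsupp] at hy; exact hy))
    (fun x ↦ by
      obtain ⟨j, hj, hxj⟩ := hcover x
      have hxs : x ∈ (chartAt H j).source := hUs j hxj.1
      have hterm : ((chartAt H j).source.indicator (fun x ↦ (ρB j : E → ℝ) (extChartAt I j x)) x) ^ 2 = 1 := by
        rw [indicator_of_mem hxs, hone j x hxj, one_pow]
      calc (1 : ℝ) = ((chartAt H (↑(⟨j, hj⟩ : ↥tF) : M)).source.indicator
            (fun x ↦ (ρB (↑(⟨j, hj⟩ : ↥tF) : M) : E → ℝ) (extChartAt I (↑(⟨j, hj⟩ : ↥tF) : M) x)) x) ^ 2 :=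
            hterm.symm
        _ ≤ ∑ j' : ↥tF, ((chartAt H (j' : M)).source.indicator
            (fun x ↦ (ρB (j' : M) : E → ℝ) (extChartAt I (j' : M) x)) x) ^ 2 :=
            Finset.single_le_sum (f := fun j' : ↥tF ↦ ((chartAt H (j' : M)).source.indicator
              (fun x ↦ (ρB (j' : M) : E → ℝ) (extChartAt I (j' : M) x)) x) ^ 2)
              (fun j' _ ↦ sq_nonneg _) (Finset.mem_univ (⟨j, hj⟩ : ↥tF)))
  -- (4) the chart energy inequalities
  have hρV : ∀ x₀, tsupport (ρB x₀ : E → ℝ) ⊆ (extChartAt I x₀).target := fun x₀ ↦ (hρU x₀).trans (hUt x₀)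
  have hρC1 : ∀ x₀, ContDiff ℝ 1 (ρB x₀ : E → ℝ) := fun x₀ ↦ (ρB x₀).contDiff
  have hchart : ∀ j : ↥tF, ∃ Ce : ℝ, 0 ≤ Ce ∧ ∀ t ∈ Icc 0 ε,
      (∫ y, (ρB j) y ^ 2 * eDens b (chartRep I g₁ (j : M) t) (chartRep I g₂ (j : M) t) y ∂μE) ≤ (∫ y, (ρB j) y ^ 2 * eDens b (chartRep I g₁ (j : M) 0) (chartRep I g₂ (j : M) 0) y ∂μE) +
        Ce * ∫ s in (0 : ℝ)..t, (∫ y in (tsupport (ρB (j : M) : E → ℝ)), eDens b (chartRep I g₁ (j : M) s) (chartRep I g₂ (j : M) s) y ∂μE) :=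
    fun j ↦ exists_chartEnergy_le (μ := μE) b hε h₁ h₂ hR₁ (j : M) (hρC1 j) (ρB (j : M)).hasCompactSupport (hρV j)
  choose Ce hCe0 hCe using hchart
  -- (5) the total energy and Grönwall
  set En : ℝ → ℝ := fun s ↦ ∑ j : ↥tF, (∫ y, (ρB j) y ^ 2 * eDens b (chartRep I g₁ (j : M) s) (chartRep I g₂ (j : M) s) y ∂μE) with hEn
  have hEn0 : ∀ s, 0 ≤ En s := fun s ↦ Finset.sum_nonneg fun j _ ↦ chartEnergy_nonneg b g₁ g₂ _ _ μE s
  have hEnc : ContinuousOn En (Icc 0 ε) :=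
    continuousOn_finsetSum _ fun j _ ↦ continuousOn_chartEnergy (μ := μE) b hε h₁ h₂ (j : M) (hρC1 j)
      (ρB (j : M)).hasCompactSupport (hρV j)
  have hEzero : ∀ j : ↥tF, (∫ y, (ρB j) y ^ 2 * eDens b (chartRep I g₁ (j : M) 0) (chartRep I g₂ (j : M) 0) y ∂μE) = 0 := fun j ↦
    chartEnergy_eq_zero_of_eq b h0 (j : M) _ μE
  have hcontc : ∀ j : ↥tF, ContinuousOn (fun t ↦ (∫ y in (tsupport (ρB (j : M) : E → ℝ)), eDens b (chartRep I g₁ (j : M) t) (chartRep I g₂ (j : M) t) y ∂μE))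
      (Icc 0 ε) := fun j ↦
    continuousOn_chartEnergyContent (μ := μE) b hε h₁ h₂ (j : M) (ρB (j : M)).hasCompactSupport (hρV j)
  set Ctot : ℝ := ∑ j : ↥tF, Ce j * D with hCtot
  have hineq : ∀ τ ∈ Icc 0 ε, En τ ≤ Ctot * ∫ s in (0 : ℝ)..τ, En s := by
    intro τ hτ
    have hsub : Icc 0 τ ⊆ Icc 0 ε := Icc_subset_Icc le_rfl hτ.2
    have hEnint : IntervalIntegrable En volume 0 τ := (hEnc.mono hsub).intervalIntegrable_of_Icc hτ.1
    have hj : ∀ j : ↥tF, (∫ y, (ρB j) y ^ 2 * eDens b (chartRep I g₁ (j : M) τ) (chartRep I g₂ (j : M) τ) y ∂μE) ≤ Ce j * D * ∫ s in (0 : ℝ)..τ, En s := by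
      intro j
      have h1 := hCe j τ hτ
      rw [hEzero j, zero_add] at h1
      have hmono : ∫ s in (0 : ℝ)..τ, (∫ y in (tsupport (ρB (j : M) : E → ℝ)), eDens b (chartRep I g₁ (j : M) s) (chartRep I g₂ (j : M) s) y ∂μE) ≤
          ∫ s in (0 : ℝ)..τ, D * En s :=
        intervalIntegral.integral_mono_on hτ.1 (((hcontc j).mono hsub).intervalIntegrable_of_Icc hτ.1)
          (hEnint.const_mul D) fun s _ ↦ hD s j
      rw [intervalIntegral.integral_const_mul] at hmono
      calc (∫ y, (ρB j) y ^ 2 * eDens b (chartRep I g₁ (j : M) τ) (chartRep I g₂ (j : M) τ) y ∂μE) ≤ Ce j * ∫ s in (0 : ℝ)..τ,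
            (∫ y in (tsupport (ρB (j : M) : E → ℝ)), eDens b (chartRep I g₁ (j : M) s) (chartRep I g₂ (j : M) s) y ∂μE) := h1
        _ ≤ Ce j * (D * ∫ s in (0 : ℝ)..τ, En s) := mul_le_mul_of_nonneg_left hmono (hCe0 j)
        _ = Ce j * D * ∫ s in (0 : ℝ)..τ, En s := by ring
    calc En τ = ∑ j : ↥tF, (∫ y, (ρB j) y ^ 2 * eDens b (chartRep I g₁ (j : M) τ) (chartRep I g₂ (j : M) τ) y ∂μE) := rfl
      _ ≤ ∑ j : ↥tF, Ce j * D * ∫ s in (0 : ℝ)..τ, En s := Finset.sum_le_sum fun j _ ↦ hj j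
      _ = Ctot * ∫ s in (0 : ℝ)..τ, En s := by rw [hCtot, Finset.sum_mul]
  have hEn_zero := eq_zero_of_le_mul_integral hEnc (fun s _ ↦ hEn0 s) hineq t ht
  -- (6) conclusion
  have hEj : ∀ j : ↥tF, (∫ y, (ρB j) y ^ 2 * eDens b (chartRep I g₁ (j : M) t) (chartRep I g₂ (j : M) t) y ∂μE) = 0 := fun j ↦
    (Finset.sum_eq_zero_iff_of_nonneg (fun j _ ↦ chartEnergy_nonneg b g₁ g₂ _ _ μE t)).1 hEn_zero j
      (Finset.mem_univ j)
  refine pseudoRiemannianMetric_eq_of_val_apply_eq fun x X Y ↦ ?_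
  obtain ⟨j, hj, hxj⟩ := hcover x
  have hxs : x ∈ (chartAt H j).source := hUs j hxj.1
  have hρx : (ρB j : E → ℝ) (extChartAt I j x) ≠ 0 := by rw [hone j x hxj]; exact one_ne_zero
  have hval := val_eq_of_chartEnergy_eq_zero (μ := μE) b hε h₁ h₂ j (hρC1 j) (ρB j).hasCompactSupport (hρV j)
    ht (hEj ⟨j, hj⟩) hxs hρx
  rw [hval]

end Main

end Literature.Geometry.Riemannian

end
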